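import Summits.BirchSwinnertonDyer.BirchSwinnertonDyer.Theorems.TameQuarticManinParityTwistPairAtThree
import HarnessLib

/-!
# Route `TameQuarticManinParity`, crux `TprimeRedManinUnitOfThreeDvdDegree` (stmt-BirchSwinnertonDyer-24627, LINE 9
# hard half; parent `TprimeReducibleManinUnit` 23737): the `χ₋₃` twist pair on the REDUCIBLE (t′) rows, and the
# `III` side of both hard halves (`--supports`)

Sequel to `TameQuarticManinParityTwistPairAtThree.lean` (seat bsd-line-ttd-p1 g4). THEOREMS ONLY; nothing is closed;
BSD is not proved by this; Manin's conjecture at `3` is not proved by this.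

* The aligned twist transport of §3 there (`TwistPairAtThree.not_three_dvd_c_of_twist_negThree_of_III`, from cell
  bsd-f2-manin's `maninLocalTwoThree_not_dvd_maninConstant_of_untwist_pStar_aligned`) uses NO irreducibility and NO
  degree hypothesis, so it serves LINE 9's reducible rows verbatim: `tprimeRed_IIIstar_of_III_partner{,_of_cns}` — on
  the binders of `TprimeRedManinUnitOfThreeDvdDegree` (24627) restricted to `ord₃ Δ_min(W) = 9` (Kodaira `III*`),
  `3 ∤ c(D)` follows from ONE datum with `3 ∤ c` (resp., granted ČNS, with `3 ∤ deg` at the conductor level) on ONE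
  globally minimal type-`III` curve `A` with `A ⊗ χ₋₃ ∼ W` (a rational `3`-isogeny inside the class is allowed: the
  transport is along the twist, not along the isogeny). The item's own warning «the optimal curve may sit at either end
  of the 3-isogeny» concerns WHICH member is optimal, not this transfer.
* The `III` side of both hard halves, at the twist MODEL (no transport along the class is claimed):
  `padicValInt_c_le_one_of_III_row` — for `W` in (t′) with `ord₃ Δ_min(W) = 3` and a conductor-level lattice-optimal
  datum `D`, ONE datum with `3 ∤ c` on a globally minimal model of `W ⊗ χ₋₃` at a level dividing `N(W)` gives
  `ord₃ c(D) ≤ 1` ("at most once", Edixhoven 1991 Thm. 3's exceptional clause, here at `p = 3` on (t′)).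

References: [Stevens1989] Lemmas (5.2), (5.4); [Pal2012] Prop. 2.5, Lemma 3.1; [EdixhovenManin1991] Thm. 3, §4;
[CesnaviciusNeururerSaha2023] Thm. 1.2.
-/

set_option autoImplicit false
-- single-conjunct summit: `Summit.BirchSwinnertonDyer.BirchSwinnertonDyer.…` repeats the name by design
set_option linter.dupNamespace false

noncomputable section

open scoped Classical

open WeierstrassCurve Literature.NumberTheory.EllipticCurves Literature.NumberTheory.EllipticCurves.ModularForms
  Literature.NumberTheory.EllipticCurves.Rank1Residual Summit.BirchSwinnertonDyer.Rank1Residual.Additive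
  Summit.BirchSwinnertonDyer.BirchSwinnertonDyer.Theorems

namespace Summit.BirchSwinnertonDyer.BirchSwinnertonDyer.Theorems.TameQuarticManinParity.TwistPairAtThree

/-! ### §1 LINE 9's hard half on the `III*` stratum, from the `III` partner (reducible rows) -/

/-- **LINE 9's hard half on the `III*` stratum, from the `III` partner.** On the binders of
`Theses.TameQuarticManinParity.TprimeRedManinUnitOfThreeDvdDegree` (stmt-BirchSwinnertonDyer-24627; `E[3]` REDUCIBLE)
restricted to `ord₃ Δ_min(W) = 9` (Kodaira `III*`): `3 ∤ c(D)` as soon as SOME globally minimal `A` with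
`ord₃ Δ_min(A) = 3` and `A ⊗ χ₋₃ ∼ W` carries SOME datum `D'` at a level dividing `N(W)` with `3 ∤ c(D')`. The binders
`¬ HasCM`, (t′), reducibility, degree-minimality, `3 ∣ deg`, `ord₃ Δ_min(W) = 9` are NOT used (displayed for the item's
shape). [cite: Stevens1989, Lemmas (5.2), (5.4)] [cite: EdixhovenManin1991, §4] -/
theorem tprimeRed_IIIstar_of_III_partner
    (W : WeierstrassCurve ℚ) [W.IsElliptic] [W.IsGloballyMinimal] [NeZero (W.conductorNorm ℤ)]
    (_hcm : ¬ W.HasCM) (hadd : Addv W 3) (_ht : SubTprime W 3) (_hred : ¬ W.HasIrreducibleModPGaloisRep 3)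
    (_h9 : padicValInt 3 W.minimalDiscriminantInt = 9)
    (D : ModularParametrizationData W (W.conductorNorm ℤ))
    (hlat : ∀ z ∈ D.L.lattice, ∃ w ∈ periodLattice D.f, z = D.c * w)
    (_hmin : ∀ (W' : WeierstrassCurve ℚ) [W'.IsElliptic] (D₁ : ModularParametrizationData W' (W.conductorNorm ℤ)),
      D₁.f = D.f → D.modularDegree ≤ D₁.modularDegree)
    (_hdeg : 3 ∣ D.modularDegree)
    (A : WeierstrassCurve ℚ) [A.IsElliptic] [A.IsGloballyMinimal]
    (h3 : padicValInt 3 A.minimalDiscriminantInt = 3) (hAW : IsIsogenous (A.quadraticTwist (-3 : ℚ)) W)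
    {N' : ℕ} [NeZero N'] (D' : ModularParametrizationData A N') (hN : N' ∣ W.conductorNorm ℤ)
    (hc' : ¬ (3 : ℤ) ∣ D'.maninConstant) : ¬ (3 : ℤ) ∣ D.maninConstant :=
  not_three_dvd_c_of_twist_negThree_of_III W hadd D hlat (nine_dvd_conductorNorm_of_addv W hadd) A h3 hAW D' hN hc'

/-- **The same GRANTED ČNS (cite-only hypothesis `hCNS`)**: the `III*` row of 24627 for `W` follows from a type-`III`
(t′) partner `A` (`A ⊗ χ₋₃ ∼ W`, `N(A) ∣ N(W)`) whose CONDUCTOR-LEVEL datum `D'` has `3 ∤ deg(D')` (ČNS on `A`, where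
`27 ∤ N(A)`; ČNS needs no irreducibility). [cite: CesnaviciusNeururerSaha2023, Thm. 1.2]
[cite: Stevens1989, Lemmas (5.2), (5.4)] -/
theorem tprimeRed_IIIstar_of_III_partner_of_cns
    (hCNS : cesnaviciusNeururerSaha_padicVal_maninConstant_le_modularDegree)
    (W : WeierstrassCurve ℚ) [W.IsElliptic] [W.IsGloballyMinimal] [NeZero (W.conductorNorm ℤ)]
    (_hcm : ¬ W.HasCM) (hadd : Addv W 3) (_ht : SubTprime W 3) (_hred : ¬ W.HasIrreducibleModPGaloisRep 3)
    (_h9 : padicValInt 3 W.minimalDiscriminantInt = 9)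
    (D : ModularParametrizationData W (W.conductorNorm ℤ))
    (hlat : ∀ z ∈ D.L.lattice, ∃ w ∈ periodLattice D.f, z = D.c * w)
    (_hmin : ∀ (W' : WeierstrassCurve ℚ) [W'.IsElliptic] (D₁ : ModularParametrizationData W' (W.conductorNorm ℤ)),
      D₁.f = D.f → D.modularDegree ≤ D₁.modularDegree)
    (_hdeg : 3 ∣ D.modularDegree)
    (A : WeierstrassCurve ℚ) [A.IsElliptic] [A.IsGloballyMinimal] [NeZero (A.conductorNorm ℤ)]
    (htA : SubTprime A 3) (h3 : padicValInt 3 A.minimalDiscriminantInt = 3)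
    (hAW : IsIsogenous (A.quadraticTwist (-3 : ℚ)) W)
    (D' : ModularParametrizationData A (A.conductorNorm ℤ)) (hN : A.conductorNorm ℤ ∣ W.conductorNorm ℤ)
    (hdeg' : ¬ 3 ∣ D'.modularDegree) : ¬ (3 : ℤ) ∣ D.maninConstant := by
  refine not_three_dvd_c_of_twist_of_III_of_not_dvd_degree hCNS W hadd D hlat (nine_dvd_conductorNorm_of_addv W hadd)
    A htA h3 ?_ D' hN hdeg'
  have h : ((-1 : ℚ) ^ (3 / 2) * 3) = -3 := by norm_num
  rwa [h]

/-! ### §2 The `III` side of both hard halves: "at most once" from one good datum on the twist model -/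

/-- **`ord₃ c(D) ≤ 1` on the `III` rows from one good datum on the twist.** For `W` globally minimal in (t′) with
`ord₃ Δ_min(W) = 3` (Kodaira `III`), `D` a lattice-optimal datum at the conductor level, `V` ANY globally minimal
model of `W ⊗ χ₋₃` (`C • (W ⊗ ℚ(√−3)) = V`), and `D'` a datum of `V` at a level `N' ∣ N(W)` with `3 ∤ c(D')`:
`ord₃ c(D) ≤ 1`. Irreducibility of `E[3]` plays no role; it serves LINE 8 (24498) and LINE 9 (24627) alike on their
`III` rows. (The cell's `TeichmullerTwistDescentStarInvolution.padicValInt_c_le_one_of_twist_datum` at `p = 3` with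
`ord₃ u = 0`.) [cite: EdixhovenManin1991, Thm. 3 and §4] [cite: Stevens1989, Lemma (5.4)] -/
theorem padicValInt_c_le_one_of_III_row
    (W : WeierstrassCurve ℚ) [W.IsElliptic] [W.IsGloballyMinimal] [NeZero (W.conductorNorm ℤ)]
    (hadd : Addv W 3) (h3 : padicValInt 3 W.minimalDiscriminantInt = 3)
    (D : ModularParametrizationData W (W.conductorNorm ℤ))
    (hlat : ∀ z ∈ D.L.lattice, ∃ w ∈ periodLattice D.f, z = D.c * w)
    (V : WeierstrassCurve ℚ) [V.IsElliptic] [V.IsGloballyMinimal] (C : VariableChange ℚ)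
    (hC : C • W.quadraticTwist (-3 : ℚ) = V)
    {N' : ℕ} [NeZero N'] (D' : ModularParametrizationData V N') (hN : N' ∣ W.conductorNorm ℤ)
    (hc' : ¬ (3 : ℤ) ∣ D'.maninConstant) : padicValInt 3 D.maninConstant ≤ 1 := by
  have h : ((-1 : ℚ) ^ (3 / 2) * 3) = -3 := by norm_num
  exact padicValInt_c_le_one_of_III_of_twist_datum W V C hadd h3 (by rw [h]; exact hC) D hlat
    (nine_dvd_conductorNorm_of_addv W hadd) hN D' hc'

/-- **The `III*` rows at the twist MODEL (no class transport)**: for `W` in (t′) with `ord₃ Δ_min(W) = 9`, `D`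
lattice-optimal at the conductor level, `V` any globally minimal model of `W ⊗ χ₋₃` and `D'` a datum of `V` at a level
`N' ∣ N(W)`: `3 ∤ c(D') ⇒ 3 ∤ c(D)` (`TwistPairAtThree.not_three_dvd_c_of_IIIstar_of_twist_datum` with the twist
spelled `−3`). [cite: EdixhovenManin1991, §4] [cite: Stevens1989, Lemma (5.4)] -/
theorem not_three_dvd_c_of_IIIstar_row
    (W : WeierstrassCurve ℚ) [W.IsElliptic] [W.IsGloballyMinimal] [NeZero (W.conductorNorm ℤ)]
    (hadd : Addv W 3) (ht : SubTprime W 3) (h9 : padicValInt 3 W.minimalDiscriminantInt = 9)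
    (D : ModularParametrizationData W (W.conductorNorm ℤ))
    (hlat : ∀ z ∈ D.L.lattice, ∃ w ∈ periodLattice D.f, z = D.c * w)
    (V : WeierstrassCurve ℚ) [V.IsElliptic] [V.IsGloballyMinimal] (C : VariableChange ℚ)
    (hC : C • W.quadraticTwist (-3 : ℚ) = V)
    {N' : ℕ} [NeZero N'] (D' : ModularParametrizationData V N') (hN : N' ∣ W.conductorNorm ℤ)
    (hc' : ¬ (3 : ℤ) ∣ D'.maninConstant) : ¬ (3 : ℤ) ∣ D.maninConstant := by
  have h : ((-1 : ℚ) ^ (3 / 2) * 3) = -3 := by norm_num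
  exact not_three_dvd_c_of_IIIstar_of_twist_datum W V C hadd ht h9 (by rw [h]; exact hC) D hlat
    (nine_dvd_conductorNorm_of_addv W hadd) hN D' hc'

end Summit.BirchSwinnertonDyer.BirchSwinnertonDyer.Theorems.TameQuarticManinParity.TwistPairAtThree

end
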